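import Mathlib
import Literature.Combinatorics.Kakeya.FiniteFieldKakeya
import HarnessLib

/-!
# Small Kakeya sets in `𝔽_qⁿ` (Saraf–Sudan 2008, Theorem 7: Dvir's construction)

Topic `Literature/Combinatorics/Kakeya`.  Everything in this file is PROVED (no named fact, no
`sorry`).  Companion to `FiniteFieldKakeya.lean` (Dvir's lower bound `|K| ≥ C(q + n − 1, n)` for
Kakeya sets `K ⊆ 𝔽_qⁿ`): the matching UPPER bound — Kakeya sets of size `2^{−(n−1)} qⁿ + O(q^{n−1})`
exist in every dimension over every finite field — so that the least size of a Kakeya set in `𝔽_qⁿ`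
is `qⁿ` up to a factor depending only on `n` (between `1 / n!` and `2^{−(n−1)} + o(1)`; the later
lower bounds of Saraf–Sudan, Dvir–Kopparty–Saraf–Sudan and Bukh–Chao, not formalized here, narrow
the gap to the constant in front of `2^{−(n−1)} qⁿ`).

S. Saraf, M. Sudan, *An improved lower bound on the size of Kakeya sets over finite fields*,
Analysis & PDE **1** (2008), no. 3, 375–379 (doi:10.2140/apde.2008.1.375; arXiv:0808.2499),
§3 "An upper bound on Kakeya sets", verbatim from the printed text (p. 378):

> We include here Dvir's proof (personal communication, 2008) giving a nontrivial upper bound on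
> the size of Kakeya sets in fields of odd characteristic. The proof is based on the construction
> of Mockenhaupt and Tao [2004]. For the case of even characteristic we complement their results
> by using a variation (obtained with Swastik Kopparty) of their construction.
>
> **Theorem 7** (Dvir). For every `n ≥ 2`, and field `𝔽`, there exists a Kakeya set in `𝔽ⁿ` of
> cardinality at most `2^{−(n−1)} qⁿ + O(q^{n−1})`.
>
> *Proof.* […] *Odd characteristic:* Let
> `D_n = {⟨α₁, …, α_{n−1}, β⟩ | αᵢ, β ∈ 𝔽, αᵢ + β² is a square}`.  Now let
> `K_n = D_n ∪ (𝔽^{n−1} × {0})` […]. Consider a direction `b = ⟨b₁, …, b_n⟩`. If `b_n = 0`, for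
> `a = ⟨0, …, 0⟩` we have that `a + tb ∈ 𝔽^{n−1} × {0} ⊆ K_n`. The more interesting case is when
> `b_n ≠ 0`. In this case let `a = ⟨(b₁/(2b_n))², …, (b_{n−1}/(2b_n))², 0⟩`. The point `a + tb`
> has coordinates `⟨α₁, …, α_{n−1}, β⟩` where `αᵢ = (bᵢ/(2b_n))² + tbᵢ` and `β = tb_n`. We have
> `αᵢ + β² = (bᵢ/(2b_n) + tb_n)²` which is a square for every `i` and so `a + tb ∈ D_n ⊆ K_n`.
> […] the size of `D_n` is exactly `|D_n| = q((q + 1)/2)^{n−1}` […] `|K_n| = |D_n| + q^{n−1}`.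
> *Even characteristic:* […] `K_n = E_n = {⟨α₁, …, α_{n−1}, β⟩ | αᵢ, β ∈ 𝔽, ∃ γᵢ ∈ 𝔽 such that
> αᵢ = γᵢ² + γᵢβ}`. (As we see below `E_n` contains `𝔽^{n−1} × {0}` […].) […] If `b_n = 0`, then
> let `a = 0` […]. Now consider the case where `b_n ≠ 0`. Let
> `a = ⟨(b₁/b_n)², …, (b_{n−1}/b_n)², 0⟩` […] For `γᵢ = (bᵢ/b_n)`,
> `γᵢ² + γᵢβ = (bᵢ/b_n)² + tbᵢ = αᵢ`. Hence `a + tb ∈ E_n = K_n`. […] the set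
> `{γ² + βγ | γ ∈ 𝔽}` has size exactly `q/2` […] `|E_n| = (q − 1)(q/2)^{n−1} + q^{n−1}`.
>
> (p. 379) Also we note that the construction used in the even case essentially also works in the
> odd characteristic case. Specifically the set `E_n ∪ 𝔽^{n−1} × {0}` is a Kakeya set also for odd
> characteristic. Its size can also be argued to be `2^{−(n−1)} qⁿ + O(q^{n−1})`.

Coordinates: a point of `𝔽ⁿ⁺¹ = (Fin (n + 1) → K)` is written `⟨α₁, …, α_n, β⟩` with `β` the LAST
coordinate `x (Fin.last n)` and `αᵢ = x (Fin.castSucc i)`; so the printed dimension `n` is our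
`n + 1` and the printed exponent `n − 1` is our `n`.

## What is proved

* `dvirD n`, `dvirE n`, `lastZero n` (defs) — the sets `D`, `E` and `𝔽ⁿ × {0}` of the proof, in
  `𝔽ⁿ⁺¹`.
* `isKakeya_dvirD_union` — **`D ∪ (𝔽ⁿ × {0})` is a Kakeya set** (odd characteristic, i.e.
  `2 ≠ 0` in `K`; any field, finite or not); `isKakeya_dvirE_union` — **`E ∪ (𝔽ⁿ × {0})` is a
  Kakeya set over EVERY field** (the closing remark of the paper); `isKakeya_dvirE` — in
  characteristic `2`, `E ⊇ 𝔽ⁿ × {0}` is itself a Kakeya set (finite `K`).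
* `ncard_dvirD` — **`|D| = q ((q + 1)/2)ⁿ` exactly** (`q` odd); `ncard_dvirE_union` —
  `|E ∪ (𝔽ⁿ × {0})| = qⁿ + (q − 1) ((q + 1)/2)ⁿ` exactly, for every finite field (for `q` even
  `(q + 1)/2 = q/2` and the union is `E`: `ncard_dvirE`, **`|E| = (q − 1)(q/2)ⁿ + qⁿ`** as printed);
  `ncard_dvirD_union_le` — `|D ∪ (𝔽ⁿ × {0})| ≤ q ((q + 1)/2)ⁿ + qⁿ`.
* `exists_isKakeya_ncard_le` — **Theorem 7 with explicit constants: over every finite field and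
  for every `n`, some Kakeya set `S ⊆ 𝔽_qⁿ⁺¹` has `|S| ≤ qⁿ + (q − 1) ((q + 1)/2)ⁿ`**;
  `exists_isKakeya_two_pow_mul_ncard_le` — hence `2ⁿ |S| ≤ qⁿ⁺¹ + 2ⁿ⁺¹ qⁿ`, i.e.
  `|S| ≤ 2^{−n} qⁿ⁺¹ + 2 qⁿ` (the printed `2^{−(n−1)} qⁿ + O(q^{n−1})` in dimension `n`, with `2` as
  the `O`-constant); `exists_isKakeya_card_le` — the same with a `Finset`.
* Tools: `two_mul_card_image_eq` (if the fibres of `f` are the orbits `{x, σ x}` of an involution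
  `σ`, then `2 · #range f = #domain + #Fix σ`), whence `card_isSquare` (`#{c ∈ 𝔽_q : c is a square}
  = (q + 1)/2`, `q` odd) and `card_range_sq_add_self` (`#{γ² + γ : γ ∈ 𝔽_q} = ⌊(q + 1)/2⌋` for every
  finite field — the printed "2-to-1" count, done once for `β = 1` and transported to `β ≠ 0` by
  the scaling `γ ↦ γ/β`).

Proof architecture: as printed (the two explicit base points, and the two counts).  The only
deviations: (i) the size of `E ∪ (𝔽ⁿ × {0})` is computed exactly in every characteristic at once
(the points with `β ≠ 0` are `(q − 1) · #{γ² + γβ}ⁿ` and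
`#{γ² + γβ : γ} = #{γ² + γ : γ} = ⌊(q+1)/2⌋` for `β ≠ 0`), which gives Theorem 7 for all finite
fields from the single set `E ∪ (𝔽ⁿ × {0})`, as the paper's closing remark says; (ii) the
statement is given for `𝔽ⁿ⁺¹`, `n ≥ 0` (the printed `n ≥ 2` is our `n ≥ 1`; for `n = 0` the set is
all of `𝔽¹`).

## Not in this file

* The recursive variant `K_n = D_n ∪ (K_{n−1} × {0})` (arXiv version, Theorem 9; it only improves
  the `O(q^{n−1})` term), the product remark `β ≤ 1/√2` from Mockenhaupt–Tao.
* The lower bounds of the same paper (Theorem 1 / Lemma 6, `|K| ≥ qⁿ / C(2n − 1, n) ≥ (q/4)ⁿ`, by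
  the method of multiplicities) and the later sharper constants (Dvir–Kopparty–Saraf–Sudan
  `|K| ≥ qⁿ/2ⁿ`; Bukh–Chao `|K| ≥ qⁿ/(2 − 1/q)^{n−1}`).

## References
* [SarafSudan2008KakeyaFiniteFields] S. Saraf, M. Sudan, Analysis & PDE 1 (2008), no. 3, 375–379 —
  §3, Theorem 7 (Dvir) and its proof, pp. 378–379 (arXiv:0808.2499 numbers it Theorem 8).
* [MockenhauptTao2004RestrictionKakeyaFiniteFields] G. Mockenhaupt, T. Tao, *Restriction and
  Kakeya phenomena for finite fields*, Duke Math. J. 121 (2004), 35–74 — the planar construction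
  `{(s, t) : s + t² is a square}` on which `D` is modelled (not used in any proof here).
* [Dvir2009FiniteFieldKakeya] Z. Dvir, J. Amer. Math. Soc. 22 (2009) 1093–1097 — the definition
  of a Kakeya set (`IsKakeya`, file `FiniteFieldKakeya.lean`) and the matching lower bound.
-/

namespace Literature.Combinatorics.Kakeya

namespace FiniteFieldKakeya

open Finset

variable {K : Type*} [Field K]

/-! ### A counting lemma: maps whose fibres are the orbits of an involution -/

/-- If the fibres of `f : α → β` are exactly the orbits `{x, σ x}` of an involution `σ` of a finite
type `α`, then `2 · #(range f) = #α + #{x : σ x = x}` (each value is taken twice, except the values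
at fixed points of `σ`, taken once). [folklore] -/
theorem two_mul_card_image_eq {α β : Type*} [Fintype α] [DecidableEq α] [DecidableEq β]
    (f : α → β) (σ : α → α) (hσ : Function.Involutive σ)
    (hf : ∀ x y, f y = f x ↔ y = x ∨ y = σ x) :
    2 * (univ.image f).card = Fintype.card α + (univ.filter fun x => σ x = x).card := by
  classical
  set R := (univ : Finset α).image f with hR
  have hfib : ∀ x, (univ.filter fun y => f y = f x) = insert x {σ x} := by
    intro x
    ext y
    simp only [mem_filter, mem_univ, true_and, mem_insert, mem_singleton, hf x y]
  let P : β → Prop := fun b => ∃ x, f x = b ∧ σ x = x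
  have hval : ∀ b ∈ R, (univ.filter fun y => f y = b).card = if P b then 1 else 2 := by
    intro b hb
    obtain ⟨x, -, rfl⟩ := mem_image.1 hb
    rw [hfib x]
    by_cases hx : σ x = x
    · rw [if_pos ⟨x, rfl, hx⟩, hx, insert_eq_of_mem (mem_singleton_self x), card_singleton]
    · rw [if_neg, card_insert_of_notMem, card_singleton]
      · rw [mem_singleton]
        exact fun h => hx h.symm
      · rintro ⟨x', hx'f, hx'σ⟩
        rcases (hf x x').1 hx'f with rfl | h'
        · exact hx hx'σ
        · apply hx
          rw [h', hσ x] at hx'σ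
          exact hx'σ.symm
  have hsum : Fintype.card α = ∑ b ∈ R, (univ.filter fun y => f y = b).card := by
    rw [← card_univ]
    exact card_eq_sum_card_fiberwise fun x _ => mem_image_of_mem f (mem_univ x)
  have hsum' : Fintype.card α + (R.filter P).card = 2 * R.card := by
    rw [hsum, sum_congr rfl hval, card_filter, ← sum_add_distrib, card_eq_sum_ones R, mul_sum]
    refine sum_congr rfl fun b _ => ?_
    split_ifs <;> rfl
  have hfix : (R.filter P).card = (univ.filter fun x => σ x = x).card := by
    symm
    refine card_bij (fun x _ => f x) (fun x hx => ?_) (fun x hx x' hx' h => ?_) (fun b hb => ?_)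
    · exact mem_filter.2 ⟨mem_image_of_mem f (mem_univ x), x, rfl, (mem_filter.1 hx).2⟩
    · rcases (hf x' x).1 h with h' | h'
      · exact h'
      · rw [h', (mem_filter.1 hx').2]
    · obtain ⟨-, x, hx, hσx⟩ := mem_filter.1 hb
      exact ⟨x, mem_filter.2 ⟨mem_univ _, hσx⟩, hx⟩
  omega

/-- **The number of squares in a finite field of odd characteristic is `(q + 1)/2`** (the count
"`(q + 1)/2` choices for each `αᵢ + β²`" of the proof, p. 378): the squaring map is `2`-to-`1`
onto the nonzero squares. [folklore] -/
theorem card_isSquare [Fintype K] (h2 : (2 : K) ≠ 0) :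
    Nat.card {c : K // IsSquare c} = (Fintype.card K + 1) / 2 := by
  classical
  have hN : Nat.card {c : K // IsSquare c} = (univ.image fun r : K => r * r).card := by
    rw [Nat.card_eq_fintype_card]
    refine Fintype.card_of_subtype _ fun c => ?_
    simp only [mem_image, mem_univ, true_and, IsSquare, eq_comm]
  have h := two_mul_card_image_eq (fun r : K => r * r) (fun r => -r) neg_neg
    fun x y => mul_self_eq_mul_self_iff
  have hfix : (univ.filter fun x : K => -x = x) = {0} := by
    ext x
    simp only [mem_filter, mem_univ, true_and, mem_singleton]
    constructor
    · intro hx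
      have h2x : (2 : K) * x = 0 := by linear_combination (-1 : K) * hx
      exact (mul_eq_zero.1 h2x).resolve_left h2
    · rintro rfl
      exact neg_zero
  rw [hfix, card_singleton] at h
  rw [hN]
  omega

/-- **The set `{γ² + γ : γ ∈ 𝔽_q}` has exactly `⌊(q + 1)/2⌋` elements, for every finite field**
(for `q` even this is the printed "`{γ² + βγ | γ ∈ 𝔽}` has size exactly `q/2` […] the map
`γ ↦ γ² + βγ` is a 2-to-1 map on its image", p. 379, at `β = 1`; for `q` odd the fibre over the
value at `γ = −1/2` is a singleton and the count is `(q + 1)/2`). [folklore] -/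
theorem card_range_sq_add_self [Fintype K] :
    Nat.card (Set.range fun γ : K => γ ^ 2 + γ) = (Fintype.card K + 1) / 2 := by
  classical
  have hN : Nat.card (Set.range fun γ : K => γ ^ 2 + γ) =
      (univ.image fun γ : K => γ ^ 2 + γ).card := by
    rw [Nat.card_eq_fintype_card, ← Set.toFinset_card, Set.toFinset_range]
  have h := two_mul_card_image_eq (fun γ : K => γ ^ 2 + γ) (fun γ => -γ - 1)
    (fun γ => by ring) fun x y => by
      constructor
      · intro hxy
        have hm : (y - x) * (y + x + 1) = 0 := by linear_combination hxy
        rcases mul_eq_zero.1 hm with h0 | h0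
        · exact Or.inl (sub_eq_zero.1 h0)
        · exact Or.inr (by linear_combination h0)
      · rintro (rfl | rfl)
        · rfl
        · ring
  have hfix : (univ.filter fun x : K => -x - 1 = x).card ≤ 1 := by
    refine card_le_one.2 fun x hx x' hx' => ?_
    have ex := (mem_filter.1 hx).2
    have ex' := (mem_filter.1 hx').2
    by_cases h2 : (2 : K) = 0
    · exfalso
      apply one_ne_zero (α := K)
      linear_combination (-1 : K) * ex - x * h2
    · have hm : (2 : K) * (x - x') = 0 := by linear_combination ex' - ex
      exact sub_eq_zero.1 ((mul_eq_zero.1 hm).resolve_left h2)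
  rw [hN]
  omega

/-! ### The sets `D`, `E` and `𝔽ⁿ × {0}` -/

/-- `𝔽ⁿ × {0} ⊆ 𝔽ⁿ⁺¹`: the points whose last coordinate `β` vanishes ("the set `{⟨a, 0⟩ | a ∈ 𝔽ⁿ}`",
p. 378). [cite: SarafSudan2008KakeyaFiniteFields, §3 proof of Theorem 7 (p. 378)] -/
def lastZero (n : ℕ) : Set (Fin (n + 1) → K) :=
  {x | x (Fin.last n) = 0}

/-- Dvir's set `D = {⟨α₁, …, α_n, β⟩ : αᵢ + β² is a square for every i} ⊆ 𝔽ⁿ⁺¹` (odd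
characteristic; modelled on Mockenhaupt–Tao's planar set `{(s, t) : s + t² is a square}`).
[cite: SarafSudan2008KakeyaFiniteFields, §3 proof of Theorem 7, odd characteristic (p. 378)] -/
def dvirD (n : ℕ) : Set (Fin (n + 1) → K) :=
  {x | ∀ i : Fin n, IsSquare (x (Fin.castSucc i) + x (Fin.last n) ^ 2)}

/-- The even-characteristic variant `E = {⟨α₁, …, α_n, β⟩ : ∃ γᵢ, αᵢ = γᵢ² + γᵢ β for every i}`
(obtained with Kopparty), here over any field: `αᵢ ∈ {γ² + γβ : γ ∈ 𝔽}` for every `i`.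
[cite: SarafSudan2008KakeyaFiniteFields, §3 proof of Theorem 7, even characteristic (p. 378)] -/
def dvirE (n : ℕ) : Set (Fin (n + 1) → K) :=
  {x | ∀ i : Fin n, x (Fin.castSucc i) ∈ Set.range fun γ : K => γ ^ 2 + γ * x (Fin.last n)}

/-- Membership in `lastZero`. [folklore] -/
@[simp] theorem mem_lastZero {n : ℕ} (x : Fin (n + 1) → K) :
    x ∈ lastZero n ↔ x (Fin.last n) = 0 :=
  Iff.rfl

/-- Membership in `dvirD`. [folklore] -/
@[simp] theorem mem_dvirD {n : ℕ} (x : Fin (n + 1) → K) :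
    x ∈ dvirD n ↔ ∀ i : Fin n, IsSquare (x (Fin.castSucc i) + x (Fin.last n) ^ 2) :=
  Iff.rfl

/-- Membership in `dvirE`. [folklore] -/
@[simp] theorem mem_dvirE {n : ℕ} (x : Fin (n + 1) → K) :
    x ∈ dvirE n ↔ ∀ i : Fin n, ∃ γ : K, γ ^ 2 + γ * x (Fin.last n) = x (Fin.castSucc i) :=
  Iff.rfl

/-! ### The sets are Kakeya sets -/

/-- **`K = D ∪ (𝔽ⁿ × {0})` is a Kakeya set in odd characteristic** (p. 378): a direction `b` with
`b_last = 0` has the line through the origin inside `𝔽ⁿ × {0}`; for `b_last ≠ 0` the line through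
`a = ⟨(bᵢ/(2 b_last))², 0⟩` lies in `D`, since `(bᵢ/(2b_last))² + tbᵢ + (tb_last)² =
(bᵢ/(2b_last) + tb_last)²`.  Valid over every field with `2 ≠ 0`.
[cite: SarafSudan2008KakeyaFiniteFields, §3 proof of Theorem 7, odd characteristic (p. 378)] -/
theorem isKakeya_dvirD_union (h2 : (2 : K) ≠ 0) (n : ℕ) :
    IsKakeya (dvirD n ∪ lastZero n : Set (Fin (n + 1) → K)) := by
  intro v
  by_cases hv : v (Fin.last n) = 0
  · refine ⟨0, fun a => Or.inr ?_⟩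
    simp [hv]
  · refine ⟨Fin.snoc (fun i => (v (Fin.castSucc i) / (2 * v (Fin.last n))) ^ 2) 0,
      fun a => Or.inl fun i => ⟨v (Fin.castSucc i) / (2 * v (Fin.last n)) + a * v (Fin.last n), ?_⟩⟩
    simp only [Pi.add_apply, Pi.smul_apply, smul_eq_mul, Fin.snoc_castSucc, Fin.snoc_last]
    field_simp
    ring

/-- **`E ∪ (𝔽ⁿ × {0})` is a Kakeya set over every field** (the even-characteristic argument of
p. 378 and the closing remark of p. 379): for `b_last ≠ 0` the line through
`a = ⟨(bᵢ/b_last)², 0⟩` lies in `E` with `γᵢ = bᵢ/b_last`: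
`γᵢ² + γᵢ (t b_last) = (bᵢ/b_last)² + tbᵢ`. [cite: SarafSudan2008KakeyaFiniteFields, §3 proof of
Theorem 7, even characteristic (pp. 378–379)] -/
theorem isKakeya_dvirE_union (n : ℕ) :
    IsKakeya (dvirE n ∪ lastZero n : Set (Fin (n + 1) → K)) := by
  intro v
  by_cases hv : v (Fin.last n) = 0
  · refine ⟨0, fun a => Or.inr ?_⟩
    simp [hv]
  · refine ⟨Fin.snoc (fun i => (v (Fin.castSucc i) / v (Fin.last n)) ^ 2) 0,
      fun a => Or.inl fun i => ⟨v (Fin.castSucc i) / v (Fin.last n), ?_⟩⟩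
    simp only [Pi.add_apply, Pi.smul_apply, smul_eq_mul, Fin.snoc_castSucc, Fin.snoc_last]
    field_simp
    ring

/-- In characteristic `2` over a finite field every element is a square, so `𝔽ⁿ × {0} ⊆ E`
("`E_n` contains `𝔽^{n−1} × {0}`", p. 378: `tbᵢ = γᵢ²` with `γᵢ = (tbᵢ)^{q/2}`).
[cite: SarafSudan2008KakeyaFiniteFields, §3 proof of Theorem 7, even characteristic (p. 378)] -/
theorem lastZero_subset_dvirE [Finite K] (hK : ringChar K = 2) (n : ℕ) :
    (lastZero n : Set (Fin (n + 1) → K)) ⊆ dvirE n := by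
  intro x hx i
  obtain ⟨r, hr⟩ := FiniteField.isSquare_of_char_two hK (x (Fin.castSucc i))
  refine ⟨r, ?_⟩
  rw [mem_lastZero] at hx
  show r ^ 2 + r * x (Fin.last n) = x (Fin.castSucc i)
  rw [hx, mul_zero, add_zero, hr, sq]

/-- **In characteristic `2`, `K = E` is a Kakeya set** (p. 378; finite `K`).
[cite: SarafSudan2008KakeyaFiniteFields, §3 proof of Theorem 7, even characteristic (p. 378)] -/
theorem isKakeya_dvirE [Finite K] (hK : ringChar K = 2) (n : ℕ) :
    IsKakeya (dvirE n : Set (Fin (n + 1) → K)) := by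
  have h := isKakeya_dvirE_union (K := K) n
  rwa [Set.union_eq_self_of_subset_right (lastZero_subset_dvirE hK n)] at h

/-! ### Cardinalities -/

/-- `|𝔽ⁿ × {0}| = qⁿ`. [folklore] -/
theorem ncard_lastZero [Fintype K] (n : ℕ) :
    (lastZero n : Set (Fin (n + 1) → K)).ncard = Fintype.card K ^ n := by
  have e : (lastZero n : Set (Fin (n + 1) → K)) ≃ (Fin n → K) :=
    { toFun := fun x => Fin.init x.1
      invFun := fun v => ⟨Fin.snoc v 0, by simp⟩
      left_inv := fun x => by
        apply Subtype.ext
        have hx : x.1 (Fin.last n) = 0 := x.2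
        funext j
        refine Fin.lastCases ?_ (fun i => ?_) j
        · simp [hx]
        · simp [Fin.init]
      right_inv := fun v => by
        dsimp only
        exact Fin.init_snoc _ _ }
  rw [← Nat.card_coe_set_eq, Nat.card_congr e, Nat.card_fun, Nat.card_eq_fintype_card,
    Nat.card_eq_fintype_card, Fintype.card_fin]

/-- **`|D| = q · ((q + 1)/2)ⁿ` exactly** ("`q` choices for `β` and `(q + 1)/2` choices for each
`αᵢ + β²`", p. 378; `q` odd): `D ≃ 𝔽 × {squares}ⁿ` via `x ↦ (β, (αᵢ + β²)ᵢ)`.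
[cite: SarafSudan2008KakeyaFiniteFields, §3 proof of Theorem 7, odd characteristic (p. 378)] -/
theorem ncard_dvirD [Fintype K] (h2 : (2 : K) ≠ 0) (n : ℕ) :
    (dvirD n : Set (Fin (n + 1) → K)).ncard =
      Fintype.card K * ((Fintype.card K + 1) / 2) ^ n := by
  have e : (dvirD n : Set (Fin (n + 1) → K)) ≃ K × (Fin n → {c : K // IsSquare c}) :=
    { toFun := fun x => (x.1 (Fin.last n),
        fun i => ⟨x.1 (Fin.castSucc i) + x.1 (Fin.last n) ^ 2, x.2 i⟩)
      invFun := fun p => ⟨Fin.snoc (fun i => (p.2 i).1 - p.1 ^ 2) p.1, fun i => by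
        simpa only [Fin.snoc_castSucc, Fin.snoc_last, sub_add_cancel] using (p.2 i).2⟩
      left_inv := fun x => by
        apply Subtype.ext
        funext j
        refine Fin.lastCases ?_ (fun i => ?_) j
        · simp
        · simp
      right_inv := fun p => by
        ext i
        · simp
        · simp }
  rw [← Nat.card_coe_set_eq, Nat.card_congr e, Nat.card_prod, Nat.card_fun, card_isSquare h2,
    Nat.card_eq_fintype_card, Nat.card_eq_fintype_card, Fintype.card_fin]

/-- The points of `E` with `β ≠ 0` number exactly `(q − 1) · ⌊(q + 1)/2⌋ⁿ` over every finite field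
("for `β ≠ 0`, the number of points of the form `⟨α₁, …, α_{n−1}, β⟩` in `E_n` is exactly
`(q/2)^{n−1}`", p. 379, there for `q` even): `{x ∈ E : β ≠ 0} ≃ 𝔽^× × {γ² + γ : γ ∈ 𝔽}ⁿ` via
`x ↦ (β, (αᵢ/β²)ᵢ)`, since `αᵢ = γ² + γβ` iff `αᵢ/β² = (γ/β)² + γ/β`.
[cite: SarafSudan2008KakeyaFiniteFields, §3 proof of Theorem 7, even characteristic (p. 379)] -/
theorem ncard_dvirE_inter [Fintype K] (n : ℕ) :
    (dvirE n ∩ {x | x (Fin.last n) ≠ 0} : Set (Fin (n + 1) → K)).ncard =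
      (Fintype.card K - 1) * ((Fintype.card K + 1) / 2) ^ n := by
  have e : (dvirE n ∩ {x | x (Fin.last n) ≠ 0} : Set (Fin (n + 1) → K)) ≃
      {b : K // b ≠ 0} × (Fin n → Set.range fun γ : K => γ ^ 2 + γ) :=
    { toFun := fun x => (⟨x.1 (Fin.last n), x.2.2⟩, fun i =>
        ⟨x.1 (Fin.castSucc i) / x.1 (Fin.last n) ^ 2, by
          obtain ⟨γ, hγ⟩ := x.2.1 i
          refine ⟨γ / x.1 (Fin.last n), ?_⟩
          have hb : x.1 (Fin.last n) ≠ 0 := x.2.2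
          rw [← hγ]
          field_simp⟩)
      invFun := fun p => ⟨Fin.snoc (fun i => (p.2 i).1 * p.1.1 ^ 2) p.1.1, by
        refine ⟨fun i => ?_, ?_⟩
        · obtain ⟨δ, hδ⟩ := (p.2 i).2
          refine ⟨δ * p.1.1, ?_⟩
          simp only [Fin.snoc_castSucc, Fin.snoc_last, ← hδ]
          ring
        · simpa only [Set.mem_setOf_eq, Fin.snoc_last] using p.1.2⟩
      left_inv := fun x => by
        apply Subtype.ext
        have hb : x.1 (Fin.last n) ≠ 0 := x.2.2
        funext j
        refine Fin.lastCases ?_ (fun i => ?_) j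
        · simp
        · simp only [Fin.snoc_castSucc]
          field_simp
      right_inv := fun p => by
        have hb : p.1.1 ≠ 0 := p.1.2
        ext i
        · simp
        · simp only [Fin.snoc_castSucc, Fin.snoc_last]
          field_simp }
  rw [← Nat.card_coe_set_eq, Nat.card_congr e, Nat.card_prod, Nat.card_fun,
    card_range_sq_add_self, Nat.card_congr (unitsEquivNeZero (G₀ := K)).symm, Nat.card_units,
    Nat.card_eq_fintype_card, Nat.card_eq_fintype_card, Fintype.card_fin]

/-- **`|E ∪ (𝔽ⁿ × {0})| = qⁿ + (q − 1) ⌊(q + 1)/2⌋ⁿ` exactly, over every finite field**: the union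
is the disjoint union of `𝔽ⁿ × {0}` and the points of `E` with `β ≠ 0`.
[cite: SarafSudan2008KakeyaFiniteFields, §3 proof of Theorem 7 (pp. 378–379)] -/
theorem ncard_dvirE_union [Fintype K] (n : ℕ) :
    (dvirE n ∪ lastZero n : Set (Fin (n + 1) → K)).ncard =
      Fintype.card K ^ n + (Fintype.card K - 1) * ((Fintype.card K + 1) / 2) ^ n := by
  have hU : (dvirE n ∪ lastZero n : Set (Fin (n + 1) → K)) =
      lastZero n ∪ (dvirE n ∩ {x | x (Fin.last n) ≠ 0}) := by
    ext x
    simp only [Set.mem_union, mem_lastZero, Set.mem_inter_iff, Set.mem_setOf_eq]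
    by_cases hx : x (Fin.last n) = 0
    · simp [hx]
    · simp [hx]
  rw [hU, Set.ncard_union_eq, ncard_lastZero, ncard_dvirE_inter]
  exact Set.disjoint_left.2 fun x hx hx' => hx'.2 hx

/-- **In characteristic `2`: `|E| = qⁿ + (q − 1)(q/2)ⁿ`** ("`|E_n| = (q − 1)(q/2)^{n−1} + q^{n−1}`",
p. 379; finite `K`, `q` even). [cite: SarafSudan2008KakeyaFiniteFields, §3 proof of Theorem 7,
even characteristic (p. 379)] -/
theorem ncard_dvirE [Fintype K] (hK : ringChar K = 2) (n : ℕ) :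
    (dvirE n : Set (Fin (n + 1) → K)).ncard =
      Fintype.card K ^ n + (Fintype.card K - 1) * (Fintype.card K / 2) ^ n := by
  have h := ncard_dvirE_union (K := K) n
  rw [Set.union_eq_self_of_subset_right (lastZero_subset_dvirE hK n)] at h
  rw [h]
  have heven := FiniteField.even_card_of_char_two hK
  congr 3
  omega

/-- `|D ∪ (𝔽ⁿ × {0})| ≤ q ((q + 1)/2)ⁿ + qⁿ` ("the size of `K_n` is at most `|D_n| + q^{n−1}`",
p. 378; `q` odd). [cite: SarafSudan2008KakeyaFiniteFields, §3 proof of Theorem 7, odd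
characteristic (p. 378)] -/
theorem ncard_dvirD_union_le [Fintype K] (h2 : (2 : K) ≠ 0) (n : ℕ) :
    (dvirD n ∪ lastZero n : Set (Fin (n + 1) → K)).ncard ≤
      Fintype.card K * ((Fintype.card K + 1) / 2) ^ n + Fintype.card K ^ n := by
  refine (Set.ncard_union_le _ _).trans ?_
  rw [ncard_dvirD h2, ncard_lastZero]

/-! ### Theorem 7 -/

/-- **Theorem 7 (Dvir), explicit form, every finite field: in `𝔽_qⁿ⁺¹` there is a Kakeya set with
at most `qⁿ + (q − 1) ⌊(q + 1)/2⌋ⁿ` points** — the set `E ∪ (𝔽ⁿ × {0})`.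
[cite: SarafSudan2008KakeyaFiniteFields, Theorem 7 (§3, p. 378)] -/
theorem exists_isKakeya_ncard_le [Fintype K] (n : ℕ) :
    ∃ S : Set (Fin (n + 1) → K), IsKakeya S ∧
      S.ncard ≤ Fintype.card K ^ n + (Fintype.card K - 1) * ((Fintype.card K + 1) / 2) ^ n :=
  ⟨dvirE n ∪ lastZero n, isKakeya_dvirE_union n, (ncard_dvirE_union n).le⟩

/-- Arithmetic for the `O`-form: `2ⁿ (qⁿ + (q − 1) ⌊(q+1)/2⌋ⁿ) ≤ qⁿ⁺¹ + 2ⁿ⁺¹ qⁿ` for `q ≥ 2`.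
[folklore] -/
theorem two_pow_mul_bound_le {q : ℕ} (hq : 2 ≤ q) (n : ℕ) :
    2 ^ n * (q ^ n + (q - 1) * ((q + 1) / 2) ^ n) ≤ q ^ (n + 1) + 2 ^ (n + 1) * q ^ n := by
  have hM : 2 * ((q + 1) / 2) ≤ q + 1 := Nat.mul_div_le (q + 1) 2
  have h1 : 2 ^ n * ((q + 1) / 2) ^ n ≤ (q + 1) ^ n := by
    rw [← mul_pow]
    exact Nat.pow_le_pow_left hM n
  -- `(q + 1)^(k+1) ≤ q^(k+1) + 2^(k+1) q^k`
  have h2 : ∀ k : ℕ, (q + 1) ^ (k + 1) ≤ q ^ (k + 1) + 2 ^ (k + 1) * q ^ k := by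
    intro k
    induction k with
    | zero => simp
    | succ k ih =>
      have hqk : 2 * q ^ k ≤ q ^ (k + 1) := by
        rw [pow_succ]
        calc 2 * q ^ k = q ^ k * 2 := mul_comm _ _
          _ ≤ q ^ k * q := Nat.mul_le_mul_left _ hq
      have h2k : 1 ≤ 2 ^ k := Nat.one_le_two_pow
      calc (q + 1) ^ (k + 1 + 1) = (q + 1) * (q + 1) ^ (k + 1) := by ring
        _ ≤ (q + 1) * (q ^ (k + 1) + 2 ^ (k + 1) * q ^ k) := Nat.mul_le_mul_left _ ih
        _ = q ^ (k + 2) + (q ^ (k + 1) + 2 ^ (k + 1) * q ^ (k + 1)) + 2 ^ k * (2 * q ^ k) := by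
          ring
        _ ≤ q ^ (k + 2) + (2 ^ k * q ^ (k + 1) + 2 ^ (k + 1) * q ^ (k + 1))
            + 2 ^ k * q ^ (k + 1) := by
          gcongr
          · calc q ^ (k + 1) = 1 * q ^ (k + 1) := (one_mul _).symm
              _ ≤ 2 ^ k * q ^ (k + 1) := Nat.mul_le_mul_right _ h2k
        _ = q ^ (k + 1 + 1) + 2 ^ (k + 1 + 1) * q ^ (k + 1) := by ring
  rcases Nat.eq_zero_or_pos n with rfl | hn
  · simp
    omega
  · obtain ⟨k, rfl⟩ := Nat.exists_eq_add_of_le' hn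
    have hk := h2 k
    calc 2 ^ (k + 1) * (q ^ (k + 1) + (q - 1) * ((q + 1) / 2) ^ (k + 1))
        = 2 ^ (k + 1) * q ^ (k + 1) + (q - 1) * (2 ^ (k + 1) * ((q + 1) / 2) ^ (k + 1)) := by
          ring
      _ ≤ 2 ^ (k + 1) * q ^ (k + 1) + q * (q + 1) ^ (k + 1) := by
          gcongr
          · exact Nat.sub_le q 1
      _ ≤ 2 ^ (k + 1) * q ^ (k + 1) + q * (q ^ (k + 1) + 2 ^ (k + 1) * q ^ k) :=
          Nat.add_le_add_left (Nat.mul_le_mul_left _ hk) _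
      _ = q ^ (k + 1 + 1) + 2 ^ (k + 1 + 1) * q ^ (k + 1) := by ring

/-- **Theorem 7 (Dvir) in the printed shape `2^{−(n−1)} qⁿ + O(q^{n−1})`, with the `O`-constant
made explicit: in `𝔽_qⁿ⁺¹` there is a Kakeya set `S` with `2ⁿ |S| ≤ qⁿ⁺¹ + 2ⁿ⁺¹ qⁿ`, i.e.
`|S| ≤ 2^{−n} qⁿ⁺¹ + 2 qⁿ`** (every finite field, every `n`).
[cite: SarafSudan2008KakeyaFiniteFields, Theorem 7 (§3, p. 378)] -/
theorem exists_isKakeya_two_pow_mul_ncard_le [Fintype K] (n : ℕ) :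
    ∃ S : Set (Fin (n + 1) → K), IsKakeya S ∧
      2 ^ n * S.ncard ≤ Fintype.card K ^ (n + 1) + 2 ^ (n + 1) * Fintype.card K ^ n := by
  obtain ⟨S, hS, hcard⟩ := exists_isKakeya_ncard_le (K := K) n
  refine ⟨S, hS, (Nat.mul_le_mul_left _ hcard).trans ?_⟩
  exact two_pow_mul_bound_le (Fintype.one_lt_card) n

/-- Theorem 7 with a `Finset`: some Kakeya set `S ⊆ 𝔽_qⁿ⁺¹` has
`2ⁿ |S| ≤ qⁿ⁺¹ + 2ⁿ⁺¹ qⁿ` (compare Dvir's lower bound `FiniteFieldKakeya.choose_le_card`: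
`|S| ≥ C(q + n, n + 1) ≥ qⁿ⁺¹ / (n + 1)!` for every Kakeya set).
[cite: SarafSudan2008KakeyaFiniteFields, Theorem 7 (§3, p. 378)] -/
theorem exists_isKakeya_card_le [Fintype K] (n : ℕ) :
    ∃ S : Finset (Fin (n + 1) → K), IsKakeya (↑S : Set (Fin (n + 1) → K)) ∧
      2 ^ n * S.card ≤ Fintype.card K ^ (n + 1) + 2 ^ (n + 1) * Fintype.card K ^ n := by
  classical
  obtain ⟨S, hS, hcard⟩ := exists_isKakeya_two_pow_mul_ncard_le (K := K) n
  refine ⟨S.toFinset, by rwa [Set.coe_toFinset], ?_⟩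
  rwa [Set.ncard_eq_toFinset_card' S] at hcard

end FiniteFieldKakeya

end Literature.Combinatorics.Kakeya
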